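import Summits.PneNP.PneNP.Theorems.ConvexRankGatesCliqueExtLowerBoundStubReferee
import Summits.PneNP.PneNP.Theorems.ConvexRankGatesCliqueExtLowerBoundWidthThresholdDefs
import Summits.PneNP.PneNP.Theorems.ConvexRankGatesCliqueExtLowerBoundHorns
import Mathlib

/-!
# The negative count of the pattern function "all of `P` on"
(stub `unitCnf_neg_count` of the line `width-threshold-certificate-sparsity`, §1g `LocalityMustGrow`,
crux `ConvexRankGates.CliqueExtLowerBound`, stmt-PneNP-10682; lead c13)

The negatives of the referee pair are the vectors "every edge slot on except those of `M`", `M` ranging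
over the `t`-subsets of the `n = #E(K_m) = C(m,2)` edge slots, `t = n / L`, `L = ⌊m^{1/8}⌋₊`. For a set
`P` of `r ≥ 1` slots, the negatives in which NOT all of `P` is on are those with `M ∩ P ≠ ∅`, i.e.
`C(n,t) - C(n-r,t)` of the `C(n,t)` negatives. We show that this exceeds the dual-horn threshold
`(1/(8m^{c+1}) + (r-1)/L) · C(n,t)` of `Horns.horns_of_pair` for all large `m`:

* §1 counting (any finite slot type): `C(n,t) ≤ #{negatives not all-on on P} + C(n - #P, t)`
  (`choose_le_card_filter_add`, `card_negFilter_eq`);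
* §2 numerics: `C(n-r,t)·n^t ≤ C(n,t)·(n-r)^t` (`choose_mul_pow_le_choose_mul_pow` of
  `CliqueCounting`), the second-order Bonferroni bound `(1-x)^t ≤ 1 - tx + (tx)²/2` on `[0,1]`
  (`one_sub_pow_le_bonferroni`), `y = tr/n ∈ (r/L - r/n, r/L]`, and
  `1/(8m^{c+1}) + r/n + r²/(2L²) ≤ 3/(4L) < 1/L` once `m ≥ 8r+2` and `L ≥ 2r²+1` (`neg_numerics`);
* §3 the registered stub `unitCnf_neg_count`.
-/

set_option linter.dupNamespace false

open Literature.Computability.Complexity Filter Finset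
open Summit.PneNP.PneNP.Theorems.CliqueExtLowerBound.WidthThreshold

noncomputable section

namespace Summit.PneNP.PneNP.Theorems.CliqueExtLowerBound.WidthThreshold.UnitCnfNeg

/-! ## §1 Counting -/

section Counting

variable {α : Type} [Fintype α] [DecidableEq α]

/-- Every `t`-subset of the slots either meets `P` or is a `t`-subset of the complement of `P`:
`C(n,t) ≤ #{M : M ∩ P ≠ ∅} + C(n - #P, t)`. [folklore] -/
theorem choose_le_card_filter_add (P : Finset α) (t : ℕ) :
    (Fintype.card α).choose t ≤
      #(((univ : Finset α).powersetCard t).filter fun M => ¬ ∀ e ∈ P, e ∉ M) +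
        (Fintype.card α - #P).choose t := by
  have hsub : (univ : Finset α).powersetCard t ⊆
      ((univ : Finset α).powersetCard t).filter (fun M => ¬ ∀ e ∈ P, e ∉ M) ∪
        (univ \ P).powersetCard t := by
    intro M hM
    rw [mem_union, mem_filter]
    by_cases h : ∀ e ∈ P, e ∉ M
    · exact Or.inr (mem_powersetCard.2
        ⟨fun e he => mem_sdiff.2 ⟨mem_univ _, fun heP => h e heP he⟩, (mem_powersetCard.1 hM).2⟩)
    · exact Or.inl ⟨hM, h⟩
  calc (Fintype.card α).choose t = #((univ : Finset α).powersetCard t) := by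
        rw [card_powersetCard, card_univ]
    _ ≤ _ := card_le_card hsub
    _ ≤ _ := card_union_le _ _
    _ = _ := by rw [card_powersetCard, card_univ_sdiff]

/-- On the coded negatives `M ↦ (e ↦ [e ∉ M])` (an injective coding), "not all of `P` on" reads
`M ∩ P ≠ ∅`, so the two filters have the same size. [folklore] -/
theorem card_negFilter_eq (P : Finset α) (t : ℕ) :
    #((((univ : Finset α).powersetCard t).image fun M => fun e => decide (e ∉ M)).filter
        fun x => ¬ ∀ e ∈ P, x e = true) =
      #(((univ : Finset α).powersetCard t).filter fun M => ¬ ∀ e ∈ P, e ∉ M) := by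
  rw [filter_image, card_image_of_injective _ Horns.offVec_injective]
  congr 1
  exact filter_congr fun M _ => by simp

end Counting

/-! ## §2 Numerics -/

/-- Second-order Bonferroni bound: `(1-x)^t ≤ 1 - t x + (t x)²/2` for `0 ≤ x ≤ 1`. [folklore] -/
theorem one_sub_pow_le_bonferroni {x : ℝ} (hx0 : 0 ≤ x) (hx1 : x ≤ 1) :
    ∀ t : ℕ, (1 - x) ^ t ≤ 1 - t * x + (t * x) ^ 2 / 2
  -- adapted from `one_sub_pow_le` (Literature/Barriers/AtomisticToContinuum/DisorderedHarmonicChainRyCounterexample.lean)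
  | 0 => by simp
  | t + 1 => by
    have ih := one_sub_pow_le_bonferroni hx0 hx1 t
    have hs : 0 ≤ 1 - x := by linarith
    calc (1 - x) ^ (t + 1) = (1 - x) ^ t * (1 - x) := pow_succ _ _
      _ ≤ (1 - t * x + (t * x) ^ 2 / 2) * (1 - x) := mul_le_mul_of_nonneg_right ih hs
      _ ≤ 1 - ((t + 1 : ℕ) : ℝ) * x + (((t + 1 : ℕ) : ℝ) * x) ^ 2 / 2 := by
          push_cast
          nlinarith [mul_nonneg (sq_nonneg (t : ℝ)) (pow_nonneg hx0 3), sq_nonneg x,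
            mul_nonneg (Nat.cast_nonneg t) (sq_nonneg x)]

/-- **Numerics for the negative count.** With `n = C(m,2)`, `L = ⌊m^{1/8}⌋₊`, `t = n / L` and `r ≥ 1`:
eventually in `m`, every `A` with `C(n,t) ≤ A + C(n-r,t)` satisfies
`(1/(8m^{c+1}) + (r-1)/L) · C(n,t) < A` (since `C(n-r,t) ≤ C(n,t)(1 - r/n)^t ≤ C(n,t)(1 - y + y²/2)`,
`y = tr/n > r/L - r/n`, `y ≤ r/L`, and `1/(8m^{c+1}) + r/n + r²/(2L²) ≤ 3/(4L)`). [folklore] -/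
theorem neg_numerics (c r : ℕ) (hr : 1 ≤ r) : ∀ᶠ m : ℕ in atTop, ∀ A : ℕ,
    (m.choose 2).choose (m.choose 2 / ⌊(m : ℝ) ^ (1 / 8 : ℝ)⌋₊) ≤
        A + (m.choose 2 - r).choose (m.choose 2 / ⌊(m : ℝ) ^ (1 / 8 : ℝ)⌋₊) →
      (1 / (8 * (m : ℝ) ^ (c + 1)) + ((r - 1 : ℕ) : ℝ) / ⌊(m : ℝ) ^ (1 / 8 : ℝ)⌋₊) *
          ((m.choose 2).choose (m.choose 2 / ⌊(m : ℝ) ^ (1 / 8 : ℝ)⌋₊) : ℝ) < A := by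
  have hLt : Tendsto (fun m : ℕ => ⌊(m : ℝ) ^ (1 / 8 : ℝ)⌋₊) atTop atTop :=
    tendsto_nat_floor_atTop.comp
      ((tendsto_rpow_atTop (by norm_num)).comp tendsto_natCast_atTop_atTop)
  filter_upwards [eventually_ge_atTop (8 * r + 2), hLt.eventually_ge_atTop (2 * r ^ 2 + 1)] with
    m hm hLm A hA
  set L : ℕ := ⌊(m : ℝ) ^ (1 / 8 : ℝ)⌋₊ with hL
  set n : ℕ := m.choose 2 with hn
  set t : ℕ := n / L with ht
  have hLm' : 2 * r ^ 2 + 1 ≤ L := hLm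
  -- integer-side facts
  have hL1 : 1 ≤ L := le_trans (Nat.le_add_left 1 _) hLm'
  have hm2 : 2 ≤ m := by omega
  have hn0 : 0 < n := Nat.choose_pos hm2
  have htn : t ≤ n := Nat.div_le_self n L
  have hC0 : 0 < n.choose t := Nat.choose_pos htn
  have htL : t * L ≤ n := Nat.div_mul_le_self n L
  have hnlt : n < t * L + L := Nat.lt_div_mul_add hL1
  -- real-side facts
  have hL0 : (0 : ℝ) < L := by exact_mod_cast hL1
  have hn0r : (0 : ℝ) < n := by exact_mod_cast hn0
  have hC0r : (0 : ℝ) < n.choose t := by exact_mod_cast hC0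
  have hr0 : (0 : ℝ) < r := by exact_mod_cast hr
  have hm1 : (1 : ℝ) ≤ m := by exact_mod_cast (show 1 ≤ m by omega)
  have htLr : (t : ℝ) * L ≤ n := by exact_mod_cast htL
  have hnltr : (n : ℝ) < t * L + L := by exact_mod_cast hnlt
  have hLm2 : 2 * (r : ℝ) ^ 2 + 1 ≤ L := by exact_mod_cast hLm'
  -- `L ≤ m^{1/8} ≤ m`
  have hLmr : (L : ℝ) ≤ m :=
    calc (L : ℝ) ≤ (m : ℝ) ^ (1 / 8 : ℝ) := Nat.floor_le (by positivity)
      _ ≤ (m : ℝ) ^ (1 : ℝ) := Real.rpow_le_rpow_of_exponent_le hm1 (by norm_num)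
      _ = m := Real.rpow_one _
  -- `4 r L ≤ 4 r m ≤ m(m-1)/2 = n`
  have h4rL : 4 * (r : ℝ) * L ≤ n := by
    have h1 : (n : ℝ) = m * (m - 1) / 2 := by rw [hn]; exact Nat.cast_choose_two (K := ℝ) m
    have h2 : (8 * r + 2 : ℝ) ≤ m := by exact_mod_cast hm
    rw [h1]
    nlinarith [mul_le_mul_of_nonneg_left hLmr (by positivity : (0 : ℝ) ≤ 4 * r),
      mul_le_mul_of_nonneg_left (show (8 * r : ℝ) ≤ m - 1 by linarith) (Nat.cast_nonneg m)]
  have hrn : r ≤ n := by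
    have : (r : ℝ) ≤ n := by nlinarith
    exact_mod_cast this
  -- the binomial ratio `C(n-r,t) ≤ C(n,t) (1 - r/n)^t`
  have hx0 : (0 : ℝ) ≤ r / n := by positivity
  have hx1 : (r : ℝ) / n ≤ 1 := (div_le_one hn0r).2 (by exact_mod_cast hrn)
  have hbin : (((n - r).choose t : ℕ) : ℝ) ≤ (n.choose t : ℝ) * (1 - r / n) ^ t := by
    have h1 := Literature.Computability.Complexity.choose_mul_pow_le_choose_mul_pow (Nat.sub_le n r) t
    have h2 : (((n - r).choose t : ℕ) : ℝ) * (n : ℝ) ^ t ≤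
        ((n.choose t : ℕ) : ℝ) * ((n : ℝ) - r) ^ t := by
      have h1' : (((n - r).choose t * n ^ t : ℕ) : ℝ) ≤ ((n.choose t * (n - r) ^ t : ℕ) : ℝ) := by
        exact_mod_cast h1
      push_cast [Nat.cast_sub hrn] at h1'
      exact h1'
    have h3 : (1 - (r : ℝ) / n) ^ t = ((n : ℝ) - r) ^ t / (n : ℝ) ^ t := by
      rw [← div_pow, sub_div, div_self hn0r.ne']
    rw [h3, mul_div_assoc', le_div_iff₀ (by positivity)]
    exact h2
  -- Bonferroni, and the window for `y = t r / n`
  have hbonf := one_sub_pow_le_bonferroni hx0 hx1 t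
  set y : ℝ := (t : ℝ) * (r / n) with hy
  have hy0 : 0 ≤ y := by positivity
  have hy1 : y ≤ r / L := by
    rw [hy, ← mul_div_assoc, div_le_div_iff₀ hn0r hL0]
    nlinarith [mul_le_mul_of_nonneg_left htLr hr0.le]
  have hy2 : (r : ℝ) / L - r / n < y := by
    have h1 : (r : ℝ) / L < (t + 1) * r / n := by
      rw [div_lt_div_iff₀ hL0 hn0r]
      nlinarith [mul_lt_mul_of_pos_left hnltr hr0]
    have h2 : ((t : ℝ) + 1) * r / n = y + r / n := by rw [hy]; ring
    linarith
  have hysq : y ^ 2 ≤ ((r : ℝ) / L) ^ 2 := pow_le_pow_left₀ hy0 hy1 2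
  -- the three small terms, each `≤ 1/(4L)`
  have ha : 1 / (8 * (m : ℝ) ^ (c + 1)) ≤ 1 / (4 * L) := by
    refine one_div_le_one_div_of_le (by positivity) ?_
    have h1 : (m : ℝ) ≤ (m : ℝ) ^ (c + 1) := le_self_pow₀ hm1 (Nat.succ_ne_zero c)
    have h2 : (0 : ℝ) ≤ (m : ℝ) ^ (c + 1) := by positivity
    linarith
  have hb : (r : ℝ) / n ≤ 1 / (4 * L) := by
    rw [div_le_div_iff₀ hn0r (by positivity)]
    linarith
  have hc' : ((r : ℝ) / L) ^ 2 / 2 ≤ 1 / (4 * L) := by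
    rw [div_pow, div_div, div_le_div_iff₀ (by positivity) (by positivity)]
    nlinarith [mul_le_mul_of_nonneg_right hLm2 (by positivity : (0 : ℝ) ≤ 2 * L)]
  have h34 : 3 * (1 / (4 * (L : ℝ))) < 1 / L := by
    rw [show 1 / (4 * (L : ℝ)) = (1 / L) / 4 by ring]
    have : 0 < 1 / (L : ℝ) := by positivity
    linarith
  have hcast : ((r - 1 : ℕ) : ℝ) / L = r / L - 1 / L := by
    rw [Nat.cast_sub hr, Nat.cast_one, sub_div]
  have hkey : 1 / (8 * (m : ℝ) ^ (c + 1)) + ((r - 1 : ℕ) : ℝ) / L < y - y ^ 2 / 2 := by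
    rw [hcast]
    linarith
  -- assemble
  have hAr : ((n.choose t : ℕ) : ℝ) ≤ A + ((n - r).choose t : ℕ) := by exact_mod_cast hA
  calc (1 / (8 * (m : ℝ) ^ (c + 1)) + ((r - 1 : ℕ) : ℝ) / L) * (n.choose t : ℝ)
      < (y - y ^ 2 / 2) * (n.choose t : ℝ) := mul_lt_mul_of_pos_right hkey hC0r
    _ ≤ (1 - (1 - r / n) ^ t) * (n.choose t : ℝ) := by
        refine mul_le_mul_of_nonneg_right ?_ hC0r.le
        linarith
    _ = (n.choose t : ℝ) - (n.choose t : ℝ) * (1 - r / n) ^ t := by ring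
    _ ≤ (n.choose t : ℝ) - ((n - r).choose t : ℕ) := by linarith
    _ ≤ A := by linarith

/-! ## §3 The stub -/

open Classical in
/-- **Negative count** (registered stub `unitCnf_neg_count`): for `r ≥ 1` and all large `m`, for every set
`P` of `r` edge slots, the negatives of the referee pair (complements of the `t`-subsets of the `#E` slots,
`t = #E/⌊m^{1/8}⌋₊`) in which NOT all of `P` is on are MORE than `(1/(8m^{c+1}) + (r-1)/⌊m^{1/8}⌋₊)·#N`,
the dual-horn threshold of `Horns.horns_of_pair`. [folklore] -/
theorem unitCnf_neg_count : ∀ c r : ℕ, 1 ≤ r → ∀ᶠ m : ℕ in atTop, ∀ P : Finset (EV m), #P = r →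
    (1 / (8 * (m : ℝ) ^ (c + 1)) + ((r - 1 : ℕ) : ℝ) / ⌊(m : ℝ) ^ (1 / 8 : ℝ)⌋₊) *
        #((powersetCard (Fintype.card (EV m) / ⌊(m : ℝ) ^ (1 / 8 : ℝ)⌋₊) (univ : Finset (EV m))).image
          (fun M => fun e => decide (e ∉ M))) <
      #(((powersetCard (Fintype.card (EV m) / ⌊(m : ℝ) ^ (1 / 8 : ℝ)⌋₊) (univ : Finset (EV m))).image
          (fun M => fun e => decide (e ∉ M))).filter fun x => ¬ ∀ e ∈ P, x e = true) := by
  intro c r hr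
  filter_upwards [neg_numerics c r hr] with m hnum P hP
  have hn : Fintype.card (EV m) = m.choose 2 := card_edgeSet_top_fin m
  rw [Referee.card_neg_eq, card_negFilter_eq, hn]
  refine hnum _ ?_
  have h := choose_le_card_filter_add P (m.choose 2 / ⌊(m : ℝ) ^ (1 / 8 : ℝ)⌋₊)
  rw [hn, hP] at h
  exact h

end Summit.PneNP.PneNP.Theorems.CliqueExtLowerBound.WidthThreshold.UnitCnfNeg

end
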